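import Literature.GroupTheory.CombinatorialGroupTheory.RandomSclFreeGroupProofs
import Mathlib.RingTheory.RootsOfUnity.Complex
import Mathlib.Algebra.Field.GeomSum
import Mathlib.Algebra.BigOperators.GroupWithZero.Finset
import Mathlib.Analysis.Complex.Trigonometric
import Mathlib.Data.Complex.BigOperators
import Mathlib.Analysis.SpecificLimits.Normed
import HarnessLib

/-!
# Random rigidity of scl (Calegari–Walker 2013): proofs, part 2 — Sharp's theorem, polynomial form

D. Calegari, A. Walker, *Random rigidity in the free group*, Geom. Topol. 17 (2013) [CalegariWalker2013],
Theorem 2.1 (R. Sharp): `|F_n'|/|F_n| ≍ n^{−k/2}` for even `n`, where `F_n` = reduced words of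
length `n` in the free group of rank `k` and `F_n' = F_n ∩ [F,F]`. Loc. cit. only uses that
conditioning on `[F,F]` costs at most a polynomial factor. We PROVE that polynomial form:

**`card_reducedWords_le_mul_card_commutatorWords`**: for `k ≥ 2`, for all large even `n`,
`|F_n| ≤ 2 (n+1)^k |F_n'|`.

Proof (elementary, no measure theory): the weighted counts `C_n(χ) = ∑_{w ∈ F_n} ∏ χ(wᵢ)` of a
character obey the cogrowth recurrence (`weightedCount_rec`, part 1); discrete Fourier inversion
on `(ℤ/M)^k`, `M = n + 1`, gives `M^k |F_n'| = ∑_θ C_n(χ_θ)`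
(`card_balanced_mul_pow_eq_sum_weightedCount`); for each `θ` the sequence is real with parameter
`a(θ) = 2∑ cos ∈ [−2k, 2k]`; in the real-root regime `a² ≥ 4(2k−1)` it is `≥ 0` for even `n`
(`rec_nonneg` and a sign flip), in the complex-root regime it is `O(n (2k−1)^{n/2})` (`rec_abs_le`
via the energy `rec_energy`), and `θ = 0` contributes `|F_n| = 2k(2k−1)^{n−1}`, which dominates.
Corollary: the transfer principle `#(F_n' ∩ bad)·|F_n| ≤ 2(n+1)^k·#(F_n ∩ bad)·|F_n'|`
(`transfer_to_commutatorWords`) — statements holding for random elements of `F_n` with probability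
`1 − o(n^{−k})` transfer to random elements of `F_n'`.
-/

noncomputable section

open Filter

namespace Literature.GroupTheory.CombinatorialGroupTheory

/-! ### Towards Theorem 2.1 (Sharp): balanced words by discrete Fourier inversion

`|F_n ∩ {all exponent sums zero}| · M^k = ∑_{θ ∈ (ℤ/M)^k} C_n(χ_θ)` for `M > n`, where
`χ_θ(x_a^{±1}) = ζ^{±θ_a}`, `ζ = e^{2πi/M}` (`card_balanced_mul_pow_eq_sum_weightedCount`): the
number of balanced reduced words — `F_n'` by `commutatorWords_eq_filter_balanced` — is an average of
the weighted counts of the cogrowth recurrence (`weightedCount_rec`). -/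

section Fourier

open scoped Classical
open Complex in
/-- Orthogonality of the characters of `ℤ/M`: `∑_{t<M} yᵗ = M` if `y = 1`, `= 0` if `y ≠ 1` but
`y^M = 1`. [folklore] -/
theorem sum_pow_eq_ite {y : ℂ} {M : ℕ} (hy : y ^ M = 1) :
    ∑ t ∈ Finset.range M, y ^ t = if y = 1 then (M : ℂ) else 0 := by
  split_ifs with h
  · simp [h]
  · rw [geom_sum_eq h, hy, sub_self, zero_div]

/-- The weight of a word is the product over the letters of `χ(x)^{#x}`. [folklore] -/
theorem prod_weight_eq_prod_pow {k n : ℕ} {S : Type*} [CommMonoid S] (χ : Fin k × Bool → S)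
    (w : Fin n → Fin k × Bool) :
    ∏ i, χ (w i) = ∏ x : Fin k × Bool, χ x ^ (Finset.univ.filter fun i => w i = x).card := by
  rw [← Finset.prod_fiberwise_of_maps_to (g := w) (t := Finset.univ) fun i _ => Finset.mem_univ _]
  refine Finset.prod_congr rfl fun x _ => ?_
  rw [Finset.prod_congr rfl fun i hi => by rw [(Finset.mem_filter.mp hi).2], Finset.prod_const]

open Complex in
/-- **Balanced reduced words by Fourier inversion.** For `M > n` and `ζ = e^{2πi/M}`,
`M^k · #{w ∈ F_n : #x_a = #x_a⁻¹ for all a} = ∑_{θ : Fin k → Fin M} ∑_{w ∈ F_n} ∏ᵢ χ_θ(wᵢ)` with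
`χ_θ(x_a) = ζ^{θ_a}`, `χ_θ(x_a⁻¹) = ζ^{−θ_a}`; by `commutatorWords_eq_filter_balanced` the left side
counts `F_n' = F_n ∩ [F,F]`, and each inner sum obeys the cogrowth recurrence `weightedCount_rec`
(`χ_θ(x)χ_θ(x⁻¹) = 1`). This is the starting point of Sharp's local limit theorem
(loc. cit. Thm. 2.1). [folklore] -/
theorem card_balanced_mul_pow_eq_sum_weightedCount (k n M : ℕ) (hM : n < M) :
    ((M : ℂ) ^ k) * (((reducedWords k n).filter fun w => ∀ a : Fin k,
        (Finset.univ.filter fun i => w i = (a, true)).card =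
          (Finset.univ.filter fun i => w i = (a, false)).card).card : ℂ) =
      ∑ θ : Fin k → Fin M, ∑ w ∈ reducedWords k n,
        ∏ i, (if (w i).2 then exp (2 * Real.pi * I / M) ^ ((θ (w i).1 : ℕ))
          else (exp (2 * Real.pi * I / M))⁻¹ ^ ((θ (w i).1 : ℕ))) := by
  have hM0 : M ≠ 0 := by omega
  set ζ : ℂ := exp (2 * Real.pi * I / M) with hζdef
  have hζ : IsPrimitiveRoot ζ M := Complex.isPrimitiveRoot_exp M hM0
  have hζM : ζ ^ M = 1 := hζ.pow_eq_one
  have hζ0 : ζ ≠ 0 := hζ.ne_zero hM0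
  -- exchange the sums
  rw [Finset.sum_comm]
  -- for each word, the sum over `θ` is `M^k [w balanced]`
  have hword : ∀ w : Fin n → Fin k × Bool, w ∈ reducedWords k n →
      ∑ θ : Fin k → Fin M, ∏ i, (if (w i).2 then ζ ^ ((θ (w i).1 : ℕ))
        else ζ⁻¹ ^ ((θ (w i).1 : ℕ))) =
      if ∀ a : Fin k, (Finset.univ.filter fun i => w i = (a, true)).card =
          (Finset.univ.filter fun i => w i = (a, false)).card then (M : ℂ) ^ k else 0 := by
    intro w _
    -- counts of each letter
    set c : Fin k × Bool → ℕ := fun x => (Finset.univ.filter fun i => w i = x).card with hc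
    -- the weight as a product over generators
    have hw : ∀ θ : Fin k → Fin M,
        ∏ i, (if (w i).2 then ζ ^ ((θ (w i).1 : ℕ)) else ζ⁻¹ ^ ((θ (w i).1 : ℕ))) =
          ∏ a : Fin k, (ζ ^ c (a, true) * ζ⁻¹ ^ c (a, false)) ^ (θ a : ℕ) := by
      intro θ
      rw [prod_weight_eq_prod_pow (fun x : Fin k × Bool =>
        if x.2 then ζ ^ ((θ x.1 : ℕ)) else ζ⁻¹ ^ ((θ x.1 : ℕ))) w, Fintype.prod_prod_type]
      refine Finset.prod_congr rfl fun a _ => ?_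
      rw [Fintype.prod_bool]
      simp only [if_true, Bool.false_eq_true, if_false, hc, mul_pow, ← pow_mul, mul_comm (θ a : ℕ)]
    simp_rw [hw]
    -- sum over `θ` factorises
    rw [← Fintype.piFinset_univ, ← Finset.prod_univ_sum (fun _ => (Finset.univ : Finset (Fin M)))
      (fun a t => (ζ ^ c (a, true) * ζ⁻¹ ^ c (a, false)) ^ (t : ℕ))]
    -- each factor is `M` or `0`
    have hfac : ∀ a : Fin k, ∑ t : Fin M, (ζ ^ c (a, true) * ζ⁻¹ ^ c (a, false)) ^ (t : ℕ) =
        if c (a, true) = c (a, false) then (M : ℂ) else 0 := by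
      intro a
      rw [Fin.sum_univ_eq_sum_range (fun t => (ζ ^ c (a, true) * ζ⁻¹ ^ c (a, false)) ^ t) M,
        sum_pow_eq_ite]
      · -- `y = 1 ↔ counts agree`
        have hca : c (a, true) ≤ n := (Finset.card_filter_le _ _).trans (by simp)
        have hcb : c (a, false) ≤ n := (Finset.card_filter_le _ _).trans (by simp)
        have hy : ζ ^ c (a, true) * ζ⁻¹ ^ c (a, false) = 1 ↔ c (a, true) = c (a, false) := by
          rw [inv_pow, mul_inv_eq_one₀ (pow_ne_zero _ hζ0)]
          constructor
          · intro h
            exact hζ.pow_inj (by omega) (by omega) h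
          · intro h
            rw [h]
        by_cases h : c (a, true) = c (a, false)
        · rw [if_pos (hy.mpr h), if_pos h]
        · rw [if_neg (fun h' => h (hy.mp h')), if_neg h]
      · have h1 : (ζ ^ c (a, true)) ^ M = 1 := by
          rw [← pow_mul, mul_comm, pow_mul, hζM, one_pow]
        have h2 : (ζ⁻¹ ^ c (a, false)) ^ M = 1 := by
          rw [← pow_mul, mul_comm, pow_mul, inv_pow, hζM, inv_one, one_pow]
        rw [mul_pow, h1, h2, one_mul]
    simp_rw [hfac]
    rw [Fintype.prod_ite_zero, Finset.prod_const, Finset.card_univ, Fintype.card_fin]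
    simp only [hc]
  rw [Finset.sum_congr rfl fun w hw => hword w hw, Finset.sum_ite, Finset.sum_const_zero,
    add_zero, Finset.sum_const, nsmul_eq_mul, mul_comm]

end Fourier

/-! ### Towards Theorem 2.1 (Sharp): analysis of the cogrowth recurrence

For a real sequence with `P_{n+3} = a P_{n+2} − q P_{n+1}`, `P_1 = a`, `P_2 = a² − q − 1` (the
weighted counts `C_n(χ_θ)`, `a = a(θ) = 2∑ cos`, `q = 2k − 1`):
* if `a² ≥ 4q`, `a ≥ 0`, `q ≥ 1` then `P_n ≥ 0` for `n ≥ 1` (`rec_nonneg`: the invariant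
  `P_{n+2} ≥ (a/2) P_{n+1} ≥ 0`) — the real-root regime contributes non-negatively;
* if `a² ≤ 4q` then `|P_{n+2}| ≤ √qⁿ (|P_2| + n √E)`, `E = P_2² − a P_2 P_1 + q P_1²`
  (`rec_abs_le`: the quadratic form `x² − a x y + q y²` is multiplied by `q` at each step) — the
  complex-root regime is `O(n q^{n/2})`, negligible against `|F_n| ≍ qⁿ`.
Together with `card_balanced_mul_pow_eq_sum_weightedCount` these are the ingredients of a polynomial
lower bound `|F_n'| ≥ |F_n| / (2(n+1)^k)` for large even `n` — the part of Sharp's theorem used in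
loc. cit. -/

section RecurrenceAnalysis

/-- **Real-root regime: non-negativity.** If `P_{n+3} = a P_{n+2} − q P_{n+1}` for all `n`,
`P_1 = a ≥ 0`, `P_2 = a² − q − 1`, `q ≥ 1` and `a² ≥ 4q`, then `P_{n+2} ≥ (a/2) P_{n+1}` and
`P_{n+1} ≥ 0` for all `n`; in particular `P_n ≥ 0` for `n ≥ 1`. [folklore] -/
theorem rec_nonneg {P : ℕ → ℝ} {a q : ℝ} (hrec : ∀ n, P (n + 3) = a * P (n + 2) - q * P (n + 1))
    (hP1 : P 1 = a) (hP2 : P 2 = a ^ 2 - q - 1) (hq : 1 ≤ q) (ha : 0 ≤ a) (h4 : 4 * q ≤ a ^ 2)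
    (n : ℕ) : a / 2 * P (n + 1) ≤ P (n + 2) ∧ 0 ≤ P (n + 1) := by
  have ha0 : 0 < a := by
    rcases ha.eq_or_lt with h | h
    · rw [← h] at h4; nlinarith
    · exact h
  induction n with
  | zero =>
    rw [hP1, hP2]
    constructor <;> nlinarith
  | succ n ih =>
    obtain ⟨h1, h2⟩ := ih
    have h3 : 0 ≤ P (n + 2) := le_trans (by positivity) h1
    refine ⟨?_, h3⟩
    rw [show n + 1 + 2 = n + 3 by rfl, hrec]
    -- `a P_{n+2} − q P_{n+1} ≥ (a/2) P_{n+2}` as `q P_{n+1} ≤ (2q/a) P_{n+2} ≤ (a/2) P_{n+2}`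
    have h5 : q * P (n + 1) ≤ a / 2 * P (n + 2) := by
      have h6 : P (n + 1) ≤ 2 / a * P (n + 2) := by
        rw [div_mul_eq_mul_div, le_div_iff₀ ha0]
        linarith
      calc q * P (n + 1) ≤ q * (2 / a * P (n + 2)) := mul_le_mul_of_nonneg_left h6 (by linarith)
        _ = (2 * q / a) * P (n + 2) := by ring
        _ ≤ a / 2 * P (n + 2) := by
            refine mul_le_mul_of_nonneg_right ?_ h3
            rw [div_le_div_iff₀ ha0 two_pos]
            nlinarith
    show a / 2 * P (n + 1 + 1) ≤ a * P (n + 2) - q * P (n + 1)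
    rw [show n + 1 + 1 = n + 2 by rfl]
    linarith

/-- The energy of the recurrence: `E_{n+1} = q E_n` for `E_n = P_{n+2}² − a P_{n+2} P_{n+1} + q P_{n+1}²`.
[folklore] -/
theorem rec_energy {P : ℕ → ℝ} {a q : ℝ} (hrec : ∀ n, P (n + 3) = a * P (n + 2) - q * P (n + 1))
    (n : ℕ) : P (n + 2) ^ 2 - a * P (n + 2) * P (n + 1) + q * P (n + 1) ^ 2 =
      q ^ n * (P 2 ^ 2 - a * P 2 * P 1 + q * P 1 ^ 2) := by
  induction n with
  | zero => simp
  | succ n ih =>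
    rw [show n + 1 + 2 = n + 3 by rfl, show n + 1 + 1 = n + 2 by rfl, hrec, pow_succ]
    linear_combination q * ih

/-- **Complex-root regime: polynomial growth.** If `P_{n+3} = a P_{n+2} − q P_{n+1}` and
`a² ≤ 4q` then `|P_{n+2}| ≤ (√q)ⁿ (|P_2| + n √E)` with `E = P_2² − a P_2 P_1 + q P_1²` (`≥ 0`).
[folklore] -/
theorem rec_abs_le {P : ℕ → ℝ} {a q : ℝ} (hrec : ∀ n, P (n + 3) = a * P (n + 2) - q * P (n + 1))
    (hq : 0 ≤ q) (h4 : a ^ 2 ≤ 4 * q) (n : ℕ) :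
    |P (n + 2)| ≤ Real.sqrt q ^ n *
      (|P 2| + n * Real.sqrt (P 2 ^ 2 - a * P 2 * P 1 + q * P 1 ^ 2)) := by
  set E := P 2 ^ 2 - a * P 2 * P 1 + q * P 1 ^ 2 with hE
  have hsq : Real.sqrt q ^ 2 = q := Real.sq_sqrt hq
  have ha2 : |a| ≤ 2 * Real.sqrt q := by
    rw [← Real.sqrt_sq_eq_abs, show 2 * Real.sqrt q = Real.sqrt (4 * q) by
      rw [Real.sqrt_mul (by norm_num), show Real.sqrt 4 = 2 by
        rw [show (4 : ℝ) = 2 ^ 2 by norm_num, Real.sqrt_sq (by norm_num)]]]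
    exact Real.sqrt_le_sqrt h4
  -- the energy is non-negative and controls `P_{n+2} − (a/2) P_{n+1}`
  have hEn : ∀ m, (P (m + 2) - a / 2 * P (m + 1)) ^ 2 ≤ q ^ m * E := by
    intro m
    have h := rec_energy hrec m
    have : (P (m + 2) - a / 2 * P (m + 1)) ^ 2 + (q - a ^ 2 / 4) * P (m + 1) ^ 2 =
        P (m + 2) ^ 2 - a * P (m + 2) * P (m + 1) + q * P (m + 1) ^ 2 := by ring
    nlinarith [sq_nonneg (P (m + 1))]
  have hE0 : 0 ≤ E := by have := hEn 0; simp at this; nlinarith [sq_nonneg (P 2 - a / 2 * P 1)]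
  have hstep : ∀ m, |P (m + 3)| ≤ Real.sqrt q * |P (m + 2)| + Real.sqrt q ^ (m + 1) * Real.sqrt E := by
    intro m
    have h1 : |P (m + 3) - a / 2 * P (m + 2)| ≤ Real.sqrt q ^ (m + 1) * Real.sqrt E := by
      have hq1 : q ^ (m + 1) = (Real.sqrt q ^ (m + 1)) ^ 2 := by
        rw [← pow_mul, mul_comm, pow_mul, hsq]
      rw [← Real.sqrt_sq_eq_abs, ← Real.sqrt_sq (pow_nonneg (Real.sqrt_nonneg q) (m + 1)), ← hq1,
        ← Real.sqrt_mul (pow_nonneg hq _)]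
      exact Real.sqrt_le_sqrt (hEn (m + 1))
    have h2 : |a / 2 * P (m + 2)| ≤ Real.sqrt q * |P (m + 2)| := by
      rw [abs_mul]
      refine mul_le_mul_of_nonneg_right ?_ (abs_nonneg _)
      rw [abs_div, abs_two]
      linarith
    calc |P (m + 3)| = |(P (m + 3) - a / 2 * P (m + 2)) + a / 2 * P (m + 2)| := by ring_nf
      _ ≤ |P (m + 3) - a / 2 * P (m + 2)| + |a / 2 * P (m + 2)| := abs_add_le _ _
      _ ≤ _ := by linarith
  induction n with
  | zero => simp
  | succ n ih =>
    have h := hstep n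
    rw [show n + 3 = n + 1 + 2 by rfl] at h
    refine h.trans ?_
    have hsqn : 0 ≤ Real.sqrt q := Real.sqrt_nonneg q
    calc Real.sqrt q * |P (n + 2)| + Real.sqrt q ^ (n + 1) * Real.sqrt E
        ≤ Real.sqrt q * (Real.sqrt q ^ n * (|P 2| + n * Real.sqrt E)) +
            Real.sqrt q ^ (n + 1) * Real.sqrt E := by
          have := mul_le_mul_of_nonneg_left ih hsqn
          linarith
      _ = Real.sqrt q ^ (n + 1) * (|P 2| + (n + 1 : ℕ) * Real.sqrt E) := by
          push_cast
          ring

end RecurrenceAnalysis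

/-! ### Towards Theorem 2.1 (Sharp), the polynomial lower bound: per-character estimates

For the assembly `(n+1)^k |F_n'| = ∑_θ C_n(χ_θ)` (`card_balanced_mul_pow_eq_sum_weightedCount`): each
`C_n(χ_θ)` is real and obeys the cogrowth recurrence with `a(θ) = 2∑ cos(2πθ_a/(n+1)) ∈ [−2k, 2k]`
(`weightedCount_rec`); the terms with `a(θ)² ≥ 4(2k−1)` are `≥ 0` for even `n` (`rec_nonneg`), the
others are `O(n (2k−1)^{n/2})` (`rec_abs_le`) — combined in `re_ge_of_complex_rec`. -/

section SharpLowerBound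

open scoped Classical ComplexConjugate
open Complex Filter

/-- The root of unity `ζ = e^{2πi/M}` has norm one, so `ζ⁻¹ = conj ζ`, and `ζᵗ + ζ⁻ᵗ` is real with
absolute value `≤ 2`. [folklore] -/
theorem rootOfUnity_facts (M t : ℕ) :
    let ζ : ℂ := exp (2 * Real.pi * I / M)
    (ζ ^ t + ζ⁻¹ ^ t).im = 0 ∧ |(ζ ^ t + ζ⁻¹ ^ t).re| ≤ 2 := by
  intro ζ
  have hnorm : ‖ζ‖ = 1 := by
    show ‖exp (2 * Real.pi * I / M)‖ = 1
    rw [show (2 * Real.pi * I / M : ℂ) = ((2 * Real.pi / M : ℝ) : ℂ) * I by push_cast; ring]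
    exact norm_exp_ofReal_mul_I _
  have hnt : ‖ζ ^ t‖ = 1 := by rw [norm_pow, hnorm, one_pow]
  have hinv : ζ⁻¹ ^ t = conj (ζ ^ t) := by rw [inv_pow, inv_eq_conj hnt]
  rw [hinv, add_conj]
  constructor
  · exact ofReal_im _
  · rw [ofReal_re, abs_mul, abs_two]
    have h := abs_re_le_norm (ζ ^ t)
    rw [hnt] at h
    linarith

/-- Real sequences hidden in a complex recurrence: if `C_{m+3} = A C_{m+2} − q C_{m+1}` with `A`
real (`A.im = 0`), `q` real, `C_0 = 1`, `C_1 = A`, `C_2 = A² − c` (`c` real), then all `C_m` are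
real and their real parts satisfy the real recurrence. [folklore] -/
theorem complex_rec_real {C : ℕ → ℂ} {A : ℂ} {q c : ℝ}
    (hrec : ∀ m, C (m + 3) = A * C (m + 2) - q * C (m + 1)) (hA : A.im = 0) (hC0 : C 0 = 1)
    (hC1 : C 1 = A) (hC2 : C 2 = A ^ 2 - c) :
    (∀ m, (C m).im = 0) ∧
      ∀ m, (C (m + 3)).re = A.re * (C (m + 2)).re - q * (C (m + 1)).re := by
  have him : ∀ m, (C m).im = 0 := by
    intro m
    induction m using Nat.strong_induction_on with
    | _ m ih =>
      match m with
      | 0 => rw [hC0]; simp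
      | 1 => rw [hC1]; exact hA
      | 2 => rw [hC2]; simp [sq, hA]
      | m + 3 =>
        rw [hrec]
        simp [Complex.mul_im, hA, ih (m + 2) (by omega), ih (m + 1) (by omega)]
  refine ⟨him, fun m => ?_⟩
  rw [hrec]
  simp [Complex.mul_re, hA, him]

/-- **Per-character lower bound.** For a complex sequence obeying the cogrowth recurrence with
real parameter `A` (`A.im = 0`), `C_0 = 1`, `C_1 = A`, `C_2 = A² − (q + 1)`, `q ≥ 1`: for even `n`,
`Re C_{n+2} ≥ −(√q)^{n+2} (|R₂| + (n+2) √E)` with `R₂ = (Re A)² − q − 1`,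
`E = R₂² − (Re A)² R₂ + q (Re A)²` — indeed `≥ 0` when `(Re A)² ≥ 4q` (`rec_nonneg`, with the sign
flip `(−1)ᵐ C_m` for `Re A < 0`), and `O(n q^{n/2})` otherwise (`rec_abs_le`). [folklore] -/
theorem re_ge_of_complex_rec {C : ℕ → ℂ} {A : ℂ} {q : ℝ}
    (hrec : ∀ m, C (m + 3) = A * C (m + 2) - q * C (m + 1)) (hA : A.im = 0) (hC0 : C 0 = 1)
    (hC1 : C 1 = A) (hC2 : C 2 = A ^ 2 - (q + 1 : ℝ)) (hq : 1 ≤ q) (n : ℕ) (hn : Even n) :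
    -(Real.sqrt q ^ (n + 2) * (|A.re ^ 2 - q - 1| + (n + 2 : ℕ) *
        Real.sqrt ((A.re ^ 2 - q - 1) ^ 2 - A.re ^ 2 * (A.re ^ 2 - q - 1) + q * A.re ^ 2))) ≤
      (C (n + 2)).re := by
  obtain ⟨him, hrecR⟩ := complex_rec_real (c := q + 1) hrec hA hC0 hC1 hC2
  set R : ℕ → ℝ := fun m => (C m).re with hRdef
  set a : ℝ := A.re with hadef
  have hR1 : R 1 = a := by simp [hRdef, hC1, hadef]
  have hR2 : R 2 = a ^ 2 - q - 1 := by
    simp only [hRdef, hC2, sub_re, hadef]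
    rw [sq, Complex.mul_re, hA, mul_zero, sub_zero, ofReal_re]
    ring
  have hrecR' : ∀ m, R (m + 3) = a * R (m + 2) - q * R (m + 1) := hrecR
  -- the quantity on the left is non-negative
  set E : ℝ := (a ^ 2 - q - 1) ^ 2 - a ^ 2 * (a ^ 2 - q - 1) + q * a ^ 2 with hEdef
  have hEeq : E = R 2 ^ 2 - a * R 2 * R 1 + q * R 1 ^ 2 := by rw [hR2, hR1, hEdef]; ring
  have hB0 : 0 ≤ Real.sqrt q ^ (n + 2) * (|a ^ 2 - q - 1| + (n + 2 : ℕ) * Real.sqrt E) := by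
    positivity
  show -(Real.sqrt q ^ (n + 2) * (|a ^ 2 - q - 1| + (n + 2 : ℕ) * Real.sqrt E)) ≤ R (n + 2)
  by_cases h4 : 4 * q ≤ a ^ 2
  · -- real roots: the term is non-negative
    refine le_trans (neg_nonpos.mpr hB0) ?_
    rcases le_or_gt 0 a with ha | ha
    · exact ((rec_nonneg hrecR' hR1 hR2 hq ha h4 (n + 1)).2)
    · -- flip signs: `m ↦ (-1)^m R m` obeys the recurrence with parameter `-a ≥ 0`
      have hrec' : ∀ m, (fun m => (-1 : ℝ) ^ m * R m) (m + 3) =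
          (-a) * (fun m => (-1 : ℝ) ^ m * R m) (m + 2) - q * (fun m => (-1 : ℝ) ^ m * R m) (m + 1) := by
        intro m
        simp only [pow_succ, hrecR' m]
        ring
      have h := (rec_nonneg (P := fun m => (-1 : ℝ) ^ m * R m) hrec' (by simp [hR1])
        (by simp [hR2]) hq (by linarith) (by nlinarith) (n + 1)).2
      obtain ⟨r, hr⟩ := hn
      rw [show n + 1 + 1 = r + r + 2 from by omega, show r + r + 2 = 2 * (r + 1) by ring, pow_mul,
        neg_one_sq, one_pow, one_mul] at h
      rw [show n + 2 = 2 * (r + 1) by omega]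
      exact h
  · -- complex roots: polynomial growth
    rw [not_le] at h4
    have h := rec_abs_le hrecR' (by linarith) h4.le n
    rw [← hEeq, hR2] at h
    have hmono : Real.sqrt q ^ n * (|a ^ 2 - q - 1| + (n : ℕ) * Real.sqrt E) ≤
        Real.sqrt q ^ (n + 2) * (|a ^ 2 - q - 1| + (n + 2 : ℕ) * Real.sqrt E) := by
      have h1 : (1 : ℝ) ≤ Real.sqrt q := by
        rw [show (1 : ℝ) = Real.sqrt 1 by simp]
        exact Real.sqrt_le_sqrt hq
      have hp : Real.sqrt q ^ n ≤ Real.sqrt q ^ (n + 2) := pow_le_pow_right₀ h1 (by omega)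
      have hE0 : 0 ≤ Real.sqrt E := Real.sqrt_nonneg E
      have hin : |a ^ 2 - q - 1| + (n : ℕ) * Real.sqrt E ≤
          |a ^ 2 - q - 1| + (n + 2 : ℕ) * Real.sqrt E := by
        push_cast
        nlinarith
      exact mul_le_mul hp hin (by positivity) (by positivity)
    exact (abs_le.mp (h.trans hmono)).1

/-- **Sharp's theorem, polynomial lower bound (the part used in loc. cit.): PROVED.** For `k ≥ 2`,
for all large even `n`, `|F_n| ≤ 2 (n+1)^k |F_n'|` — the reduced words of length `n` in the
commutator subgroup are at least a polynomial fraction of all reduced words of length `n`, so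
"conditioning on `v ∈ [F,F]` only affects probabilities by at most a polynomial factor" (loc. cit.
after Thm. 2.1; Sharp's theorem gives the exact order `n^{−k/2}`). Proof: Fourier inversion with
`M = n + 1`, the cogrowth recurrence for each character, non-negativity of the real-root characters
and the `O(n (2k−1)^{n/2})` bound for the others, against the `θ = 0` term `|F_n| = 2k(2k−1)^{n−1}`.
[cite: CalegariWalker2013, Thm. 2.1] -/
theorem card_reducedWords_le_mul_card_commutatorWords (k : ℕ) (hk : 2 ≤ k) :
    ∀ᶠ n in atTop, Even n →
      ((reducedWords k n).card : ℝ) ≤ 2 * ((n : ℝ) + 1) ^ k * (commutatorWords k n).card := by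
  -- constants
  set q : ℝ := 2 * k - 1 with hqdef
  have hk1 : (1 : ℝ) ≤ k := by exact_mod_cast (show 1 ≤ k by omega)
  have hk2 : (2 : ℝ) ≤ k := by exact_mod_cast hk
  have hq1 : 1 ≤ q := by rw [hqdef]; linarith
  have hq3 : 3 ≤ q := by rw [hqdef]; linarith
  set Ek : ℝ := (4 * k ^ 2 + 2 * k + 1) ^ 2 + (2 * k) ^ 2 * (4 * k ^ 2 + 2 * k + 1) + q * (2 * k) ^ 2
    with hEkdef
  set K : ℝ := (4 * k ^ 2 + 2 * k + 1) + Real.sqrt Ek with hKdef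
  have hK0 : 0 < K := by rw [hKdef]; positivity
  have hsq1 : (1 : ℝ) < Real.sqrt q := by
    rw [show (1 : ℝ) = Real.sqrt 1 by simp]
    exact Real.sqrt_lt_sqrt (by norm_num) (by linarith)
  have hsq0 : 0 < Real.sqrt q := by linarith
  have hsqq : Real.sqrt q ^ 2 = q := Real.sq_sqrt (by linarith)
  -- asymptotics: eventually `(n+1)^k · n · K · √q^n ≤ k q^(n-1)` i.e. small against `|F_n|/2`
  have hev : ∀ᶠ n : ℕ in atTop, 2 * (((n : ℝ) + 1) ^ k * (n * K * Real.sqrt q ^ n)) ≤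
      2 * k * q ^ (n - 1) ∧ 2 ≤ n := by
    have ht := tendsto_pow_const_div_const_pow_of_one_lt (k + 1) hsq1
    have hε : (0 : ℝ) < k / (q * K * 2 ^ (k + 1)) := by positivity
    have h1 := (ht.eventually (gt_mem_nhds hε))
    have h2 : ∀ᶠ n : ℕ in atTop, 2 ≤ n := eventually_ge_atTop 2
    filter_upwards [h1, h2] with n hn hn2
    refine ⟨?_, hn2⟩
    have hn1 : (1 : ℝ) ≤ n := by exact_mod_cast (show 1 ≤ n by omega)
    have hpos : 0 < Real.sqrt q ^ n := pow_pos hsq0 n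
    rw [div_lt_iff₀ hpos] at hn
    -- `(n+1)^k ≤ 2^k n^k`
    have hn1' : ((n : ℝ) + 1) ^ k ≤ (2 * n) ^ k :=
      pow_le_pow_left₀ (by positivity) (by linarith) k
    have hqn : q ^ (n - 1) * q = q ^ n := by
      rw [← pow_succ, Nat.sub_add_cancel (by omega)]
    have hsqn : Real.sqrt q ^ n * Real.sqrt q ^ n = q ^ n := by
      rw [← mul_pow, ← sq, hsqq]
    -- main computation
    have hKq : 0 < q * K * 2 ^ (k + 1) := by positivity
    calc 2 * (((n : ℝ) + 1) ^ k * (n * K * Real.sqrt q ^ n))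
        ≤ 2 * ((2 * n) ^ k * (n * K * Real.sqrt q ^ n)) := by gcongr
      _ = (n : ℝ) ^ (k + 1) * (K * 2 ^ (k + 1)) * Real.sqrt q ^ n := by ring
      _ ≤ (k / (q * K * 2 ^ (k + 1)) * Real.sqrt q ^ n) * (K * 2 ^ (k + 1)) * Real.sqrt q ^ n := by
          gcongr
      _ = k / q * (Real.sqrt q ^ n * Real.sqrt q ^ n) := by field_simp
      _ = 2 * k * q ^ (n - 1) / 2 := by rw [hsqn, ← hqn]; field_simp
      _ ≤ 2 * k * q ^ (n - 1) := by
          have : 0 ≤ 2 * k * q ^ (n - 1) := by positivity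
          linarith
  filter_upwards [hev] with n ⟨hn, hn2⟩ heven
  -- set-up of the Fourier side with `M = n + 1`
  set M := n + 1 with hMdef
  have hM : n < M := Nat.lt_succ_self n
  have hF := card_balanced_mul_pow_eq_sum_weightedCount k n M hM
  -- `commutatorWords = filter balanced`
  have hbal : commutatorWords k n = (reducedWords k n).filter fun w => ∀ a : Fin k,
      (Finset.univ.filter fun i => w i = (a, true)).card =
        (Finset.univ.filter fun i => w i = (a, false)).card := by
    rw [commutatorWords_eq_filter_balanced, reducedWords, Finset.filter_filter]
  rw [← hbal] at hF
  -- the characters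
  set ζ : ℂ := exp (2 * Real.pi * I / M) with hζdef
  have hζnorm : ‖ζ‖ = 1 := by
    rw [hζdef, show (2 * Real.pi * I / M : ℂ) = ((2 * Real.pi / M : ℝ) : ℂ) * I by push_cast; ring]
    exact norm_exp_ofReal_mul_I _
  have hζ0 : ζ ≠ 0 := fun h => by rw [h, norm_zero] at hζnorm; exact zero_ne_one hζnorm
  let χ : (Fin k → Fin M) → Fin k × Bool → ℂ := fun θ x =>
    if x.2 then ζ ^ ((θ x.1 : ℕ)) else ζ⁻¹ ^ ((θ x.1 : ℕ))
  have hχ : ∀ θ x, χ θ x * χ θ (x.1, !x.2) = 1 := by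
    intro θ x
    obtain ⟨a, b⟩ := x
    cases b <;> simp [χ, inv_mul_cancel₀ (pow_ne_zero _ hζ0), mul_inv_cancel₀ (pow_ne_zero _ hζ0)]
  let C : (Fin k → Fin M) → ℕ → ℂ := fun θ m => ∑ w ∈ reducedWords k m, ∏ i, χ θ (w i)
  have hFC : ((M : ℂ) ^ k) * ((commutatorWords k n).card : ℂ) = ∑ θ : Fin k → Fin M, C θ n := hF
  -- the parameter `A θ = Σ_x χ θ x` is real with `|Re A| ≤ 2k`
  have hAfacts : ∀ θ : Fin k → Fin M, (∑ x, χ θ x).im = 0 ∧ |(∑ x, χ θ x).re| ≤ 2 * k := by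
    intro θ
    have hsum : ∑ x, χ θ x = ∑ a : Fin k, (ζ ^ ((θ a : ℕ)) + ζ⁻¹ ^ ((θ a : ℕ))) := by
      rw [Fintype.sum_prod_type]
      refine Finset.sum_congr rfl fun a _ => ?_
      rw [Fintype.sum_bool]
      simp [χ]
    rw [hsum, Complex.im_sum, Complex.re_sum]
    constructor
    · exact Finset.sum_eq_zero fun a _ => (rootOfUnity_facts M (θ a)).1
    · calc |∑ a : Fin k, (ζ ^ ((θ a : ℕ)) + ζ⁻¹ ^ ((θ a : ℕ))).re|
          ≤ ∑ a : Fin k, |(ζ ^ ((θ a : ℕ)) + ζ⁻¹ ^ ((θ a : ℕ))).re| := Finset.abs_sum_le_sum_abs _ _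
        _ ≤ ∑ _a : Fin k, (2 : ℝ) := Finset.sum_le_sum fun a _ => (rootOfUnity_facts M (θ a)).2
        _ = 2 * k := by simp [mul_comm]
  -- per-character lower bound
  have hθ : ∀ θ : Fin k → Fin M, -(Real.sqrt q ^ n * (n * K)) ≤ (C θ n).re := by
    intro θ
    obtain ⟨hAim, hAre⟩ := hAfacts θ
    set A := ∑ x, χ θ x with hAdef
    have hrec : ∀ m, C θ (m + 3) = A * C θ (m + 2) - (q : ℂ) * C θ (m + 1) := by
      intro m
      show (∑ w ∈ reducedWords k (m + 3), ∏ i, χ θ (w i)) =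
        A * (∑ w ∈ reducedWords k (m + 2), ∏ i, χ θ (w i)) -
          (q : ℂ) * ∑ w ∈ reducedWords k (m + 1), ∏ i, χ θ (w i)
      rw [weightedCount_rec (χ θ) (hχ θ) m, hAdef, hqdef]
      push_cast
      ring
    have hC0 : C θ 0 = 1 := weightedCount_zero (χ θ)
    have hC1 : C θ 1 = A := weightedCount_one (χ θ)
    have hC2 : C θ 2 = A ^ 2 - (q + 1 : ℝ) := by
      show (∑ w ∈ reducedWords k 2, ∏ i, χ θ (w i)) = A ^ 2 - ((q + 1 : ℝ) : ℂ)
      rw [weightedCount_two (χ θ) (hχ θ), hAdef, hqdef]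
      push_cast
      ring
    obtain ⟨r, hr⟩ := heven
    obtain ⟨m, hm⟩ : ∃ m, n = m + 2 := ⟨n - 2, by omega⟩
    have hmeven : Even m := ⟨r - 1, by omega⟩
    have h := re_ge_of_complex_rec hrec hAim hC0 hC1 hC2 hq1 m hmeven
    rw [← hm] at h
    refine le_trans ?_ h
    rw [neg_le_neg_iff]
    refine mul_le_mul_of_nonneg_left ?_ (pow_nonneg hsq0.le n)
    -- `|a²-q-1| + n √E ≤ n K` using `|a| ≤ 2k`
    set a := A.re with hadef
    have ha2 : a ^ 2 ≤ (2 * k) ^ 2 := by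
      rw [← sq_abs]
      exact pow_le_pow_left₀ (abs_nonneg a) hAre 2
    have hq2k : q ≤ 2 * k := by rw [hqdef]; linarith
    have hR2 : |a ^ 2 - q - 1| ≤ 4 * (k : ℝ) ^ 2 + 2 * k + 1 := by
      rw [abs_le]
      constructor <;> nlinarith [sq_nonneg a]
    have hE : (a ^ 2 - q - 1) ^ 2 - a ^ 2 * (a ^ 2 - q - 1) + q * a ^ 2 ≤ Ek := by
      rw [hEkdef]
      have h1 : (a ^ 2 - q - 1) ^ 2 ≤ (4 * (k : ℝ) ^ 2 + 2 * k + 1) ^ 2 := by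
        rw [← sq_abs]
        exact pow_le_pow_left₀ (abs_nonneg _) hR2 2
      have h2 : -(a ^ 2 * (a ^ 2 - q - 1)) ≤ (2 * (k : ℝ)) ^ 2 * (4 * (k : ℝ) ^ 2 + 2 * k + 1) := by
        have h3 : |a ^ 2 * (a ^ 2 - q - 1)| ≤ (2 * (k : ℝ)) ^ 2 * (4 * (k : ℝ) ^ 2 + 2 * k + 1) := by
          rw [abs_mul, abs_of_nonneg (sq_nonneg a)]
          exact mul_le_mul ha2 hR2 (abs_nonneg _) (by positivity)
        have h4 := neg_le_abs (a ^ 2 * (a ^ 2 - q - 1))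
        linarith
      have h3 : q * a ^ 2 ≤ q * (2 * (k : ℝ)) ^ 2 := mul_le_mul_of_nonneg_left ha2 (by linarith)
      linarith
    have hsqE : Real.sqrt ((a ^ 2 - q - 1) ^ 2 - a ^ 2 * (a ^ 2 - q - 1) + q * a ^ 2) ≤ Real.sqrt Ek :=
      Real.sqrt_le_sqrt hE
    have hn1 : (1 : ℝ) ≤ n := by exact_mod_cast (show 1 ≤ n by omega)
    have hE0 : 0 ≤ Real.sqrt Ek := Real.sqrt_nonneg _
    calc |a ^ 2 - q - 1| + (n : ℝ) * Real.sqrt ((a ^ 2 - q - 1) ^ 2 - a ^ 2 * (a ^ 2 - q - 1) + q * a ^ 2)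
        ≤ (4 * (k : ℝ) ^ 2 + 2 * k + 1) + n * Real.sqrt Ek := by gcongr
      _ ≤ n * (4 * (k : ℝ) ^ 2 + 2 * k + 1) + n * Real.sqrt Ek := by nlinarith
      _ = n * K := by rw [hKdef]; ring
  -- the trivial character contributes `|F_n|`
  have hθ0 : C 0 n = (reducedWords k n).card := by
    show ∑ w ∈ reducedWords k n, ∏ i, χ 0 (w i) = _
    rw [Finset.sum_congr rfl fun w _ => by
      rw [Finset.prod_eq_one fun i _ => by simp [χ]], Finset.sum_const, nsmul_eq_mul, mul_one]
  -- lower bound for the Fourier sum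
  have hsumge : ((reducedWords k n).card : ℝ) - ((M : ℝ) ^ k) * (Real.sqrt q ^ n * (n * K)) ≤
      ∑ θ : Fin k → Fin M, (C θ n).re := by
    have hg : ∀ θ : Fin k → Fin M, (if θ = 0 then ((reducedWords k n).card : ℝ)
        else -(Real.sqrt q ^ n * (n * K))) ≤ (C θ n).re := by
      intro θ
      split_ifs with h0
      · rw [h0, hθ0]; simp
      · exact hθ θ
    refine le_trans ?_ (Finset.sum_le_sum fun θ _ => hg θ)
    rw [Finset.sum_ite, Finset.sum_const, Finset.sum_const, nsmul_eq_mul, nsmul_eq_mul]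
    have hc1 : ((Finset.univ.filter fun θ : Fin k → Fin M => θ = 0).card : ℝ) = 1 := by
      rw [Finset.filter_eq' Finset.univ (0 : Fin k → Fin M)]
      simp
    have hc2 : ((Finset.univ.filter fun θ : Fin k → Fin M => ¬ θ = 0).card : ℝ) ≤ (M : ℝ) ^ k := by
      calc ((Finset.univ.filter fun θ : Fin k → Fin M => ¬ θ = 0).card : ℝ)
          ≤ (Finset.univ : Finset (Fin k → Fin M)).card := by exact_mod_cast Finset.card_filter_le _ _
        _ = (M : ℝ) ^ k := by simp
    rw [hc1, one_mul]
    have hB : 0 ≤ Real.sqrt q ^ n * (n * K) := by positivity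
    nlinarith
  -- take real parts of the Fourier identity
  have hre : ((M : ℝ) ^ k) * ((commutatorWords k n).card : ℝ) = ∑ θ : Fin k → Fin M, (C θ n).re := by
    have h := congrArg Complex.re hFC
    rw [Complex.re_sum] at h
    have h' : ((M : ℂ) ^ k * ((commutatorWords k n).card : ℂ)).re =
        (M : ℝ) ^ k * (commutatorWords k n).card := by
      rw [show ((M : ℂ) ^ k * ((commutatorWords k n).card : ℂ)) =
        (((M ^ k * (commutatorWords k n).card : ℕ)) : ℂ) by push_cast; ring, Complex.natCast_re]
      push_cast
      ring
    rw [h'] at h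
    exact h
  -- `|F_n| = 2k q^(n-1)`
  have hFn : ((reducedWords k n).card : ℝ) = 2 * k * q ^ (n - 1) := by
    rw [card_reducedWords k (by omega : 1 ≤ n), hqdef]
    push_cast [Nat.cast_sub (show 1 ≤ 2 * k by omega)]
    ring
  -- assemble
  have hMR : ((M : ℝ)) = (n : ℝ) + 1 := by rw [hMdef]; push_cast; ring
  rw [← hMR]
  have h1 : ((reducedWords k n).card : ℝ) / 2 ≤ ((M : ℝ) ^ k) * ((commutatorWords k n).card : ℝ) := by
    rw [hre]
    refine le_trans ?_ hsumge
    rw [hFn, hMR]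
    have hT : ((n : ℝ) + 1) ^ k * (Real.sqrt q ^ n * (n * K)) =
        ((n : ℝ) + 1) ^ k * (n * K * Real.sqrt q ^ n) := by ring
    rw [hT]
    linarith
  linarith

/-- **The transfer principle** ("Sharp's theorem is the fundamental tool that lets us draw
conclusions about random elements of `F_n'`", loc. cit. §2.1): for `k ≥ 2` and all large even `n`,
if a property fails for at most `B` of the reduced words of length `n`, it fails for at most `B` of
those in `[F,F]`, whose number is `≥ |F_n|/(2(n+1)^k)`; hence the failure PROBABILITY on `F_n'` is
at most `2(n+1)^k` times the failure probability on `F_n`: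
`#(F_n' ∩ bad) · |F_n| ≤ 2(n+1)^k · #(F_n ∩ bad) · |F_n'|`. [cite: CalegariWalker2013, Thm. 2.1] -/
theorem transfer_to_commutatorWords (k : ℕ) (hk : 2 ≤ k) :
    ∀ᶠ n in atTop, Even n → ∀ bad : (Fin n → Fin k × Bool) → Prop,
      ((((commutatorWords k n).filter fun w => bad w).card : ℝ)) * (reducedWords k n).card ≤
        2 * ((n : ℝ) + 1) ^ k * (((reducedWords k n).filter fun w => bad w).card : ℝ) *
          (commutatorWords k n).card := by
  classical
  filter_upwards [card_reducedWords_le_mul_card_commutatorWords k hk] with n hn heven bad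
  have h1 : (((commutatorWords k n).filter fun w => bad w).card : ℝ) ≤
      ((reducedWords k n).filter fun w => bad w).card := by
    exact_mod_cast Finset.card_le_card (Finset.filter_subset_filter _ (commutatorWords_subset k n))
  have h2 := hn heven
  have h3 : (0 : ℝ) ≤ ((commutatorWords k n).filter fun w => bad w).card := Nat.cast_nonneg _
  have h4 : (0 : ℝ) ≤ 2 * ((n : ℝ) + 1) ^ k * (commutatorWords k n).card := by positivity
  calc (((commutatorWords k n).filter fun w => bad w).card : ℝ) * (reducedWords k n).card
      ≤ (((commutatorWords k n).filter fun w => bad w).card : ℝ) *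
          (2 * ((n : ℝ) + 1) ^ k * (commutatorWords k n).card) :=
        mul_le_mul_of_nonneg_left h2 h3
    _ ≤ (((reducedWords k n).filter fun w => bad w).card : ℝ) *
          (2 * ((n : ℝ) + 1) ^ k * (commutatorWords k n).card) :=
        mul_le_mul_of_nonneg_right h1 h4
    _ = _ := by ring

end SharpLowerBound

end Literature.GroupTheory.CombinatorialGroupTheory

end
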